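import Summits.NavierStokesRegularity.NavierStokesRegularity.Theorems.FilamentSkeletonRssKelvinGateSmoothingWeak
import Summits.NavierStokesRegularity.NavierStokesRegularity.Theorems.FilamentSkeletonRssKelvinGateRotationDivFree
import HarnessLib

/-!
# Route `FilamentSkeletonRss` · crux `TransverseReductionRJ` (stmt-NavierStokesRegularity-21221), line
# `kelvin_gate`, stub S4 `EllipticSmoothing` — helper II: the weak pressure–Poisson equation of the
# rotated, forced Leray profile system

HONEST FRAMING. Bookkeeping for a HYPOTHETICAL filament-type RSS blow-up route; nothing here bears
on Navier–Stokes regularity; no stub is proved in this file.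

The S4 system is the ROTATED, FORCED backward profile system on `ℝ³`
`α(e₃ × U − DU[e₃ × y]) + ½U + ½DU[y] − ΔU + DU[U] + ∇P = F`, `div U = 0`, with `U ∈ C²`,
`P ∈ C¹` and a smooth forcing `F` (the accretion modes). As for Leray's system (Tsai 1998, (2.1);
tree `LerayProfileWeakPressure`) the pressure–Poisson equation holds only weakly at this
regularity. On top of the generic part `…SmoothingWeak` (weak Laplacian of the pressure from the
gradient identity, `C² + div U = 0` calculus) this file proves:

* `sum_pderiv_rot_eq_zero` — the rotation pair `(e₃×U)ᵢ − Σⱼ(e₃×y)ⱼ∂ⱼUᵢ` is divergence free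
  (the line's `KelvinGate.IsDivFree.rotField`, in coordinates); `pderiv_split5` (linearity);
* `profile_comp`, `pderiv_pressure_eq`, `contDiff_lowerOrder`, `sum_pderiv_lowerOrder_eq` —
  the S4 system in coordinates, the lower-order field `G` and `div G = div F − Σᵢⱼ∂ᵢUⱼ∂ⱼUᵢ`;
* `integral_pressure_mul_laplacian` — **`ΔP = Σᵢ∂ᵢFᵢ − Σᵢⱼ ∂ᵢUⱼ∂ⱼUᵢ` weakly** for the
  S4 system with any `C¹` forcing `F`.

References: T.-P. Tsai, ARMA 143 (1998), (1.3), (2.1); G. B. Folland, *Introduction to PDE*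
(1995), §6.A.
-/

set_option linter.dupNamespace false

noncomputable section

namespace Summit.NavierStokesRegularity.NavierStokesRegularity.Theorems.KelvinGate.Smoothing

open MeasureTheory Set Function
open Literature.Analysis.FluidPDE Literature.Analysis.FunctionSpaces
open scoped ENNReal ContDiff RealInnerProductSpace

/-- The components of the rotation field `𝓡U(y) = e₃ × U(y) − DU(y)[e₃ × y]` in coordinates.
[folklore] -/
theorem rotField_apply_eq {U : EuclideanSpace ℝ (Fin 3) → EuclideanSpace ℝ (Fin 3)}
    (hU : ContDiff ℝ 2 U) (i : Fin 3) (y : EuclideanSpace ℝ (Fin 3)) :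
    (cross (EuclideanSpace.single 2 1) (U y) - fderiv ℝ U y (cross (EuclideanSpace.single 2 1) y)) i =
      (cross (EuclideanSpace.single 2 1) (U y)) i -
        ∑ j, (cross (EuclideanSpace.single 2 1) y) j * pderiv j (fun z => U z i) y := by
  have hdiff : DifferentiableAt ℝ U y := (hU.differentiable (by simp)) y
  rw [PiLp.sub_apply, euclidean_fderiv_apply_comp hdiff, fderiv_apply_eq_sum_mul_pderiv]

/-- **The rotation pair is divergence free**: `Σᵢ ∂ᵢ((e₃×U)ᵢ − Σⱼ (e₃×y)ⱼ ∂ⱼUᵢ) = 0` for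
`U ∈ C²` divergence free (the line's `KelvinGate.IsDivFree.rotField`, in coordinates). [folklore] -/
theorem sum_pderiv_rot_eq_zero {U : EuclideanSpace ℝ (Fin 3) → EuclideanSpace ℝ (Fin 3)}
    (hU : ContDiff ℝ 2 U) (hdiv : VectorCalculus.IsDivFree U) (x : EuclideanSpace ℝ (Fin 3)) :
    ∑ i, pderiv i (fun y => (cross (EuclideanSpace.single 2 1) (U y)) i -
      ∑ j, (cross (EuclideanSpace.single 2 1) y) j * pderiv j (fun z => U z i) y) x = 0 := by
  have hR := KelvinGate.IsDivFree.rotField hU hdiv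
  -- the rotation field is `C¹`
  have hRc : ContDiff ℝ 1 (fun z => cross (EuclideanSpace.single 2 1) (U z) -
      fderiv ℝ U z (cross (EuclideanSpace.single 2 1) z)) := by
    refine ContDiff.sub ?_ ?_
    · have : (fun z => cross (EuclideanSpace.single 2 1) (U z)) =
          fun z => crossCLM (EuclideanSpace.single 2 1) (U z) := by
        funext z; rw [crossCLM_apply]
      rw [this]
      exact (crossCLM _).contDiff.comp (hU.of_le (by norm_num))
    · have h1 : ContDiff ℝ 1 (fderiv ℝ U) := hU.fderiv_right (m := 1) (by norm_num)
      have h2 : ContDiff ℝ 1 (fun z : EuclideanSpace ℝ (Fin 3) => cross (EuclideanSpace.single 2 1) z) := by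
        have : (fun z : EuclideanSpace ℝ (Fin 3) => cross (EuclideanSpace.single 2 1) z) =
            fun z => crossCLM (EuclideanSpace.single 2 1) z := by
          funext z; rw [crossCLM_apply]
        rw [this]; exact (crossCLM _).contDiff
      exact h1.clm_apply h2
  have hdivR := divergence_eq_sum_pderiv ((hRc.differentiable (by norm_num)) x)
    (v := fun z => cross (EuclideanSpace.single 2 1) (U z) -
      fderiv ℝ U z (cross (EuclideanSpace.single 2 1) z))
  rw [hR x] at hdivR
  have e : ∀ i, (fun y => (cross (EuclideanSpace.single 2 1) (U y)) i -
      ∑ j, (cross (EuclideanSpace.single 2 1) y) j * pderiv j (fun z => U z i) y) =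
      fun y => (cross (EuclideanSpace.single 2 1) (U y) -
        fderiv ℝ U y (cross (EuclideanSpace.single 2 1) y)) i :=
    fun i => funext fun y => (rotField_apply_eq hU i y).symm
  simp_rw [e]
  exact hdivR.symm

/-- Linearity of `∂ₗ` on the five-term combination `f₁ − a f₂ − b f₃ − f₄ − c f₅`. [folklore] -/
theorem pderiv_split5 {f₁ f₂ f₃ f₄ f₅ : EuclideanSpace ℝ (Fin 3) → ℝ} (h₁ : Differentiable ℝ f₁)
    (h₂ : Differentiable ℝ f₂) (h₃ : Differentiable ℝ f₃) (h₄ : Differentiable ℝ f₄)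
    (h₅ : Differentiable ℝ f₅) (a b c : ℝ) (l : Fin 3) (x : EuclideanSpace ℝ (Fin 3)) :
    pderiv l (fun y => f₁ y - a * f₂ y - b * f₃ y - f₄ y - c * f₅ y) x =
      pderiv l f₁ x - a * pderiv l f₂ x - b * pderiv l f₃ x - pderiv l f₄ x - c * pderiv l f₅ x := by
  have d2 : Differentiable ℝ (fun y => a * f₂ y) := h₂.const_mul a
  have d3 : Differentiable ℝ (fun y => b * f₃ y) := h₃.const_mul b
  have d5 : Differentiable ℝ (fun y => c * f₅ y) := h₅.const_mul c
  have d12 : Differentiable ℝ (fun y => f₁ y - a * f₂ y) := h₁.sub d2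
  have d123 : Differentiable ℝ (fun y => f₁ y - a * f₂ y - b * f₃ y) := d12.sub d3
  have d1234 : Differentiable ℝ (fun y => f₁ y - a * f₂ y - b * f₃ y - f₄ y) := d123.sub h₄
  rw [pderiv_sub d1234 d5, pderiv_sub d123 h₄, pderiv_sub d12 d3, pderiv_sub h₁ d2,
    pderiv_const_mul h₂, pderiv_const_mul h₃, pderiv_const_mul h₅]

/-! ### The S4 system in coordinates and its weak pressure equation -/

section System

variable {U F : EuclideanSpace ℝ (Fin 3) → EuclideanSpace ℝ (Fin 3)} {P : EuclideanSpace ℝ (Fin 3) → ℝ}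
  {α : ℝ}

/-- **The rotated forced profile system in coordinates**: for every `i`,
`−Σⱼ∂ⱼ∂ⱼUᵢ + ½Uᵢ + ½Σⱼyⱼ∂ⱼUᵢ + ΣⱼUⱼ∂ⱼUᵢ + α((e₃×U)ᵢ − Σⱼ(e₃×y)ⱼ∂ⱼUᵢ) + ∂ᵢP = Fᵢ`.
[cite: Tsai1998, (1.3)] -/
theorem profile_comp (hU : ContDiff ℝ 2 U)
    (heq : ∀ y, α • (cross (EuclideanSpace.single 2 1) (U y) -
        fderiv ℝ U y (cross (EuclideanSpace.single 2 1) y)) + (1 / 2 : ℝ) • U y +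
        (1 / 2 : ℝ) • fderiv ℝ U y y - (Laplacian.laplacian U) y + fderiv ℝ U y (U y) +
        gradient P y = F y)
    (y : EuclideanSpace ℝ (Fin 3)) (i : Fin 3) :
    -(∑ j, pderiv j (pderiv j fun z => U z i) y) + (1 / 2 : ℝ) * U y i +
      (1 / 2 : ℝ) * ∑ j, y j * pderiv j (fun z => U z i) y + ∑ j, U y j * pderiv j (fun z => U z i) y +
      α * ((cross (EuclideanSpace.single 2 1) (U y)) i -
        ∑ j, (cross (EuclideanSpace.single 2 1) y) j * pderiv j (fun z => U z i) y) +
      pderiv i P y = F y i := by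
  have hm := congrArg (fun w : EuclideanSpace ℝ (Fin 3) => w i) (heq y)
  have hdiff : DifferentiableAt ℝ U y := (hU.differentiable (by simp)) y
  simp only [PiLp.add_apply, PiLp.sub_apply, PiLp.smul_apply, smul_eq_mul] at hm
  rw [laplacian_apply_comp hU, euclidean_fderiv_apply_comp hdiff, euclidean_fderiv_apply_comp hdiff,
    euclidean_fderiv_apply_comp hdiff, fderiv_apply_eq_sum_mul_pderiv, fderiv_apply_eq_sum_mul_pderiv,
    fderiv_apply_eq_sum_mul_pderiv, gradient_apply_comp] at hm
  linarith

/-- The pressure gradient solved from the S4 system: `∂ᵢP = Σⱼ∂ⱼ∂ⱼUᵢ + Gᵢ` with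
`Gᵢ = Fᵢ − ½Uᵢ − ½Σⱼyⱼ∂ⱼUᵢ − ΣⱼUⱼ∂ⱼUᵢ − α((e₃×U)ᵢ − Σⱼ(e₃×y)ⱼ∂ⱼUᵢ)`. [cite: Tsai1998, (1.3)] -/
theorem pderiv_pressure_eq (hU : ContDiff ℝ 2 U)
    (heq : ∀ y, α • (cross (EuclideanSpace.single 2 1) (U y) -
        fderiv ℝ U y (cross (EuclideanSpace.single 2 1) y)) + (1 / 2 : ℝ) • U y +
        (1 / 2 : ℝ) • fderiv ℝ U y y - (Laplacian.laplacian U) y + fderiv ℝ U y (U y) +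
        gradient P y = F y)
    (i : Fin 3) (y : EuclideanSpace ℝ (Fin 3)) :
    pderiv i P y = (∑ j, pderiv j (pderiv j fun z => U z i) y) +
      (F y i - (1 / 2 : ℝ) * U y i - (1 / 2 : ℝ) * ∑ j, y j * pderiv j (fun z => U z i) y -
        ∑ j, U y j * pderiv j (fun z => U z i) y -
        α * ((cross (EuclideanSpace.single 2 1) (U y)) i -
          ∑ j, (cross (EuclideanSpace.single 2 1) y) j * pderiv j (fun z => U z i) y)) := by
  have h1 := profile_comp hU heq y i
  linarith

/-- The lower-order field `G` of the S4 system is `C¹` (for `U ∈ C²`, `F ∈ C¹`). [folklore] -/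
theorem contDiff_lowerOrder (hU : ContDiff ℝ 2 U) (hF : ContDiff ℝ 1 F) (i : Fin 3) :
    ContDiff ℝ 1 fun y : EuclideanSpace ℝ (Fin 3) =>
      F y i - (1 / 2 : ℝ) * U y i - (1 / 2 : ℝ) * ∑ j, y j * pderiv j (fun z => U z i) y -
        ∑ j, U y j * pderiv j (fun z => U z i) y -
        α * ((cross (EuclideanSpace.single 2 1) (U y)) i -
          ∑ j, (cross (EuclideanSpace.single 2 1) y) j * pderiv j (fun z => U z i) y) := by
  have hUc : ∀ i, ContDiff ℝ 2 (fun z => U z i) := fun i => contDiff_comp_euclidean hU i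
  have hU1 : ∀ i, ContDiff ℝ 1 (fun z => U z i) := fun i => (hUc i).of_le (by norm_num)
  have hd1 : ∀ i j, ContDiff ℝ 1 (pderiv j fun z => U z i) := fun i j =>
    contDiff_one_pderiv_of_contDiff_two (hUc i) j
  have hF1 : ContDiff ℝ 1 (fun z => F z i) := contDiff_comp_euclidean hF i
  have hcU : ContDiff ℝ 1 (fun y => (cross (EuclideanSpace.single 2 1) (U y)) i) := by
    have h : ContDiff ℝ 1 (fun y => crossCLM (EuclideanSpace.single 2 1) (U y)) :=
      (crossCLM (EuclideanSpace.single 2 1)).contDiff.comp (hU.of_le (by norm_num) : ContDiff ℝ 1 U)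
    exact contDiff_comp_euclidean h i
  have hcy : ∀ j, ContDiff ℝ 1 (fun y : EuclideanSpace ℝ (Fin 3) => (cross (EuclideanSpace.single 2 1) y) j) := by
    intro j
    have h : ContDiff ℝ 1 (fun y : EuclideanSpace ℝ (Fin 3) => crossCLM (EuclideanSpace.single 2 1) y) :=
      (crossCLM (EuclideanSpace.single 2 1)).contDiff
    exact contDiff_comp_euclidean h j
  refine ((((hF1.sub (contDiff_const.mul (hU1 i))).sub (contDiff_const.mul
    (ContDiff.sum fun j _ => (contDiff_euclideanCoord j).mul (hd1 i j)))).sub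
    (ContDiff.sum fun j _ => (hU1 j).mul (hd1 i j))).sub
    (contDiff_const.mul (hcU.sub (ContDiff.sum fun j _ => (hcy j).mul (hd1 i j)))))

/-- **The divergence of the lower-order field**: for `U ∈ C²` divergence free,
`Σᵢ ∂ᵢGᵢ = Σᵢ ∂ᵢFᵢ − Σᵢⱼ ∂ᵢUⱼ∂ⱼUᵢ` (the scaling, drift and rotation terms are divergence free,
the convective term contributes `tr(DU²)`). [cite: Tsai1998, (2.1)] -/
theorem sum_pderiv_lowerOrder_eq (hU : ContDiff ℝ 2 U) (hdiv : VectorCalculus.IsDivFree U)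
    (hF : ContDiff ℝ 1 F) (x : EuclideanSpace ℝ (Fin 3)) :
    ∑ i, pderiv i (fun y : EuclideanSpace ℝ (Fin 3) =>
      F y i - (1 / 2 : ℝ) * U y i - (1 / 2 : ℝ) * ∑ j, y j * pderiv j (fun z => U z i) y -
        ∑ j, U y j * pderiv j (fun z => U z i) y -
        α * ((cross (EuclideanSpace.single 2 1) (U y)) i -
          ∑ j, (cross (EuclideanSpace.single 2 1) y) j * pderiv j (fun z => U z i) y)) x =
      ∑ i, pderiv i (fun z => F z i) x -
        ∑ i, ∑ j, pderiv i (fun z => U z j) x * pderiv j (fun z => U z i) x := by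
  have hUc : ∀ i, ContDiff ℝ 2 (fun z => U z i) := fun i => contDiff_comp_euclidean hU i
  have hU1 : ∀ i, ContDiff ℝ 1 (fun z => U z i) := fun i => (hUc i).of_le (by norm_num)
  have hUd : ∀ i, Differentiable ℝ (fun z => U z i) := fun i => (hU1 i).differentiable one_ne_zero
  have hd1 : ∀ i j, ContDiff ℝ 1 (pderiv j fun z => U z i) := fun i j =>
    contDiff_one_pderiv_of_contDiff_two (hUc i) j
  have hdd : ∀ i j, Differentiable ℝ (pderiv j fun z => U z i) := fun i j =>
    (hd1 i j).differentiable one_ne_zero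
  have hFd : ∀ i, Differentiable ℝ (fun z => F z i) := fun i =>
    (contDiff_comp_euclidean hF i).differentiable one_ne_zero
  -- differentiability of the five pieces
  have hN₂d : ∀ i, Differentiable ℝ (fun y : EuclideanSpace ℝ (Fin 3) =>
      ∑ j, y j * pderiv j (fun z => U z i) y) := fun i =>
    Differentiable.fun_sum fun j _ => (differentiable_euclideanCoord j).mul (hdd i j)
  have hN₁d : ∀ i, Differentiable ℝ (fun y : EuclideanSpace ℝ (Fin 3) =>
      ∑ j, U y j * pderiv j (fun z => U z i) y) := fun i =>
    Differentiable.fun_sum fun j _ => (hUd j).mul (hdd i j)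
  have hcUd : ∀ i, Differentiable ℝ (fun y => (cross (EuclideanSpace.single 2 1) (U y)) i) := by
    intro i
    have h : ContDiff ℝ 1 (fun y => crossCLM (EuclideanSpace.single 2 1) (U y)) :=
      (crossCLM (EuclideanSpace.single 2 1)).contDiff.comp (hU.of_le (by norm_num) : ContDiff ℝ 1 U)
    exact (contDiff_comp_euclidean h i).differentiable one_ne_zero
  have hcyd : ∀ j, Differentiable ℝ (fun y : EuclideanSpace ℝ (Fin 3) => (cross (EuclideanSpace.single 2 1) y) j) := by
    intro j
    have h : ContDiff ℝ 1 (fun y : EuclideanSpace ℝ (Fin 3) => crossCLM (EuclideanSpace.single 2 1) y) :=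
      (crossCLM (EuclideanSpace.single 2 1)).contDiff
    exact (contDiff_comp_euclidean h j).differentiable one_ne_zero
  have hRd : ∀ i, Differentiable ℝ (fun y : EuclideanSpace ℝ (Fin 3) =>
      (cross (EuclideanSpace.single 2 1) (U y)) i -
        ∑ j, (cross (EuclideanSpace.single 2 1) y) j * pderiv j (fun z => U z i) y) := fun i =>
    (hcUd i).sub (Differentiable.fun_sum fun j _ => (hcyd j).mul (hdd i j))
  -- split the divergence
  have hsplit : ∀ i, pderiv i (fun y : EuclideanSpace ℝ (Fin 3) =>
      F y i - (1 / 2 : ℝ) * U y i - (1 / 2 : ℝ) * ∑ j, y j * pderiv j (fun z => U z i) y -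
        ∑ j, U y j * pderiv j (fun z => U z i) y -
        α * ((cross (EuclideanSpace.single 2 1) (U y)) i -
          ∑ j, (cross (EuclideanSpace.single 2 1) y) j * pderiv j (fun z => U z i) y)) x =
      pderiv i (fun z => F z i) x - (1 / 2 : ℝ) * pderiv i (fun z => U z i) x -
        (1 / 2 : ℝ) * pderiv i (fun y => ∑ j, y j * pderiv j (fun z => U z i) y) x -
        pderiv i (fun y => ∑ j, U y j * pderiv j (fun z => U z i) y) x -
        α * pderiv i (fun y => (cross (EuclideanSpace.single 2 1) (U y)) i -
          ∑ j, (cross (EuclideanSpace.single 2 1) y) j * pderiv j (fun z => U z i) y) x := by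
    intro i
    have h := pderiv_split5 (hFd i) (hUd i) (hN₂d i) (hN₁d i) (hRd i) (1 / 2 : ℝ) (1 / 2 : ℝ) α i x
    exact h
  simp_rw [hsplit, Finset.sum_sub_distrib, ← Finset.mul_sum,
    hdiv.sum_pderiv_comp_eq_zero (hU.differentiable (by simp)) x, sum_pderiv_drift_eq_zero hU hdiv x,
    sum_pderiv_convect_eq hU hdiv x, sum_pderiv_rot_eq_zero hU hdiv x]
  ring

/-- **The weak pressure–Poisson equation of the S4 system**: for `U ∈ C²` divergence free,
`P ∈ C¹`, `F ∈ C¹` solving the rotated forced profile system and every smooth compactly supported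
complex `ψ`, `∫ P Σᵢ∂ᵢ∂ᵢψ = ∫ (Σᵢ∂ᵢFᵢ − Σᵢⱼ∂ᵢUⱼ∂ⱼUᵢ) ψ`. [cite: Tsai1998, (2.1)] -/
theorem integral_pressure_mul_laplacian (hU : ContDiff ℝ 2 U) (hdiv : VectorCalculus.IsDivFree U)
    (hP : ContDiff ℝ 1 P) (hF : ContDiff ℝ 1 F)
    (heq : ∀ y, α • (cross (EuclideanSpace.single 2 1) (U y) -
        fderiv ℝ U y (cross (EuclideanSpace.single 2 1) y)) + (1 / 2 : ℝ) • U y +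
        (1 / 2 : ℝ) • fderiv ℝ U y y - (Laplacian.laplacian U) y + fderiv ℝ U y (U y) +
        gradient P y = F y)
    (ψ : EuclideanSpace ℝ (Fin 3) → ℂ) (hψ : ContDiff ℝ ∞ ψ) (hψs : HasCompactSupport ψ) :
    ∫ x, (P x : ℂ) * ∑ i, fderiv ℝ (fun y => fderiv ℝ ψ y (EuclideanSpace.basisFun (Fin 3) ℝ i)) x
        (EuclideanSpace.basisFun (Fin 3) ℝ i) =
      ∫ x, ((∑ i, pderiv i (fun z => F z i) x -
        ∑ i, ∑ j, pderiv i (fun z => U z j) x * pderiv j (fun z => U z i) x : ℝ) : ℂ) * ψ x := by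
  rw [integral_mul_laplacian_eq_of_gradient hU hdiv hP (fun i => contDiff_lowerOrder hU hF i)
    (fun i x => pderiv_pressure_eq hU heq i x) ψ hψ hψs]
  refine integral_congr_ae (Filter.Eventually.of_forall fun x => ?_)
  beta_reduce
  rw [sum_pderiv_lowerOrder_eq (α := α) hU hdiv hF x]

end System

end Summit.NavierStokesRegularity.NavierStokesRegularity.Theorems.KelvinGate.Smoothing

end
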